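import Literature.AnabelianGeometry.SemiGraphs.CoveringComparison

/-!
# `φ^*` of the covering `𝒢_A → 𝒢` through the component anabelioids ([SemiAnbd] Def. 2.2 (i) — brick G5(a))

Mochizuki, *Semi-graphs of anabelioids*, Publ. RIMS **42** (2006) 221–322, §2 p. 23
[cite: MochizukiSemiAnbd2006, Def. 2.2(i) p.23].  For the covering `φ : 𝒢_A → 𝒢` attached to an
object `A` of `B(𝒢)` (`CoveringOfObject.lean`), the pull-back functor `φ^* : B(𝒢) ⥤ B(𝒢_A)`
(abc-iut-L3-t1's `Hom.pullbackFunctor`) is — up to the insertion of the models `Over P ≌ (𝒢_A)_{(v,P)}`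
— the functor with vertex components `B ↦ (P × B_v → P)` (`Over.star P` after `ρ_v`), edge
components `B ↦ (Q × B_e → Q)` and gluings the canonical
`b^*(P × B_v) ×_{b^*P} Q ≅ Q × b^* B_v ≅ Q × B_e`.  This file records exactly that:
`pullbackFunctor_iso_liftOver : φ^* ≅ liftOver pullbackV pullbackE pullbackGlue`, reducing the global
clause `φ^* ≅ (A × −) ⋙ toCovering A` (`Hom.IsBObjCoveringOf`) to a comparison inside the component
anabelioids (`liftOverIso`, `CoveringLift.lean`).
-/

namespace Literature.AnabelianGeometry.SemiGraphs

namespace SemiGraphOfAnabelioids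

open CategoryTheory CategoryTheory.Limits CategoryTheory.PreGaloisCategory
open Literature.AnabelianGeometry.Anabelioids

universe w' w v₁ u₁ u

-- Mathlib's `Over.pullback` / `Over.star` simp lemmas (`pullback.lift_fst`, …) only fire under the
-- pre-v4.2x defeq transparency behaviour, exactly as in `Mathlib/CategoryTheory/Comma/Over/Pullback.lean`.
set_option backward.isDefEq.respectTransparency false

namespace BObj

variable {𝒢 : SemiGraphOfAnabelioids.{v₁, u₁, u}} (A : 𝒢.BObj)

/-! ### The data of `φ^*` on the component anabelioids -/

/-- Vertex components of `φ^*` on the component anabelioids: `B ↦ (P × B_v → P)`.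
[cite: MochizukiSemiAnbd2006, Def. 2.2(i) p.23] -/
noncomputable def pullbackV (vc : A.fibreData.total.Vertex) :
    𝒢.BObj ⥤ Over ((A.vComp vc).1 : 𝒢.V (A.fibreData.proj.vertexMap vc)) :=
  𝒢.ρ (A.fibreData.proj.vertexMap vc) ⋙ Over.star ((A.vComp vc).1 : 𝒢.V (A.fibreData.proj.vertexMap vc))

/-- Edge components of `φ^*` on the component anabelioids: `B ↦ (Q × B_e → Q)`.
[cite: MochizukiSemiAnbd2006, Def. 2.2(i) p.23] -/
noncomputable def pullbackE (ec : A.fibreData.total.Edge) :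
    𝒢.BObj ⥤ Over ((A.eComp ec).1 : 𝒢.E (A.fibreData.proj.edgeMap ec)) :=
  𝒢.ρE (A.fibreData.proj.edgeMap ec) ⋙ Over.star ((A.eComp ec).1 : 𝒢.E (A.fibreData.proj.edgeMap ec))

/-- The gluings of `φ^*` on the component anabelioids: `b^*(P × B_v) ×_{b^*P} Q ≅ Q × b^* B_v ≅ Q × B_e`
(the canonical `gluingStarIsoCan`, then `ψ_b^B`). [cite: MochizukiSemiAnbd2006, Def. 2.2(i) p.23] -/
noncomputable def pullbackGlue (bc : A.fibreData.total.Branch) (vc : A.fibreData.total.Vertex)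
    (h : A.fibreData.total.abuts bc = some vc) :
    A.pullbackV vc ⋙ A.gluingAt bc vc h ≅ A.pullbackE (A.fibreData.total.edgeOf bc) :=
  show (𝒢.ρ (A.fibreData.proj.vertexMap vc) ⋙ Over.star ((A.vComp vc).1 : 𝒢.V (A.fibreData.proj.vertexMap vc))) ⋙
      A.gluingFunctor (abuts_fst h) (A.vComp vc).1 (A.brComp bc).1 (brComp_le_branchImage h) ≅
      𝒢.ρE (𝒢.graph.edgeOf (A.fibreData.proj.branchMap bc)) ⋙
        Over.star ((A.brComp bc).1 : 𝒢.E (𝒢.graph.edgeOf (A.fibreData.proj.branchMap bc))) from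
    Functor.isoWhiskerLeft (𝒢.ρ (A.fibreData.proj.vertexMap vc))
        (A.gluingStarIsoCan (abuts_fst h) (A.vComp vc).1 (A.brComp bc).1 (brComp_le_branchImage h)) ≪≫
      Functor.isoWhiskerRight
        (𝒢.ψNatIso (A.fibreData.proj.branchMap bc) (A.fibreData.proj.vertexMap vc) (abuts_fst h))
        (Over.star ((A.brComp bc).1 : 𝒢.E (𝒢.graph.edgeOf (A.fibreData.proj.branchMap bc))))

/-- Components of `pullbackGlue`: the canonical comparison at `B_v`, then `Q × ψ_b^B`.
[cite: MochizukiSemiAnbd2006, Def. 2.2(i) p.23] -/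
theorem pullbackGlue_hom_app (bc : A.fibreData.total.Branch) (vc : A.fibreData.total.Vertex)
    (h : A.fibreData.total.abuts bc = some vc) (B : 𝒢.BObj) :
    (A.pullbackGlue bc vc h).hom.app B =
      (A.gluingStarIsoCan (abuts_fst h) (A.vComp vc).1 (A.brComp bc).1 (brComp_le_branchImage h)).hom.app
          (B.S (A.fibreData.proj.vertexMap vc)) ≫
        (Over.star ((A.brComp bc).1 : 𝒢.E (𝒢.graph.edgeOf (A.fibreData.proj.branchMap bc)))).map
          (B.ψ (A.fibreData.proj.branchMap bc) (A.fibreData.proj.vertexMap vc) (abuts_fst h)).hom :=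
  rfl

/-! ### Unfolding the covering morphism -/

/-- The 2-cells of `𝒢_A → 𝒢` are the `twoIso`s. [cite: MochizukiSemiAnbd2006, Def. 2.2(i) p.23] -/
theorem coveringHomCan_φB (bc : A.fibreData.total.Branch) (vc : A.fibreData.total.Vertex)
    (h : A.fibreData.total.abuts bc = some vc) : A.coveringHomCan.φB bc vc h = A.twoIsoCan bc vc h := rfl

/-- Components of the 2-cell `twoIso`: cancel the unit of `Over P ≌ model`, then the canonical
`gluingStarIsoCan`, inside the model. [cite: MochizukiSemiAnbd2006, Def. 2.2(i) p.23] -/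
theorem twoIsoCan_hom_app (bc : A.fibreData.total.Branch) (vc : A.fibreData.total.Vertex)
    (h : A.fibreData.total.abuts bc = some vc) (Y : 𝒢.V (A.fibreData.proj.vertexMap vc)) :
    (A.twoIsoCan bc vc h).hom.app Y =
      (A.gluingAt bc vc h ⋙ A.toBr bc).map
          ((Shrink.equivalence (Over ((A.vComp vc).1 : 𝒢.V (A.fibreData.proj.vertexMap vc)))).unitInv.app
            ((Over.star ((A.vComp vc).1 : 𝒢.V (A.fibreData.proj.vertexMap vc))).obj Y)) ≫
        (A.toBr bc).map ((A.gluingStarIsoCan (abuts_fst h) (A.vComp vc).1 (A.brComp bc).1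
          (brComp_le_branchImage h)).hom.app Y) :=
  rfl

/-! ### `φ^*` is a lifted functor -/

/-- **`φ^* ≅ liftOver pullbackV pullbackE pullbackGlue`**: the pull-back functor of `𝒢_A → 𝒢` is the
functor lifted from `B ↦ (P × B_v → P)`, `B ↦ (Q × B_e → Q)` and the canonical gluings, the
identification being the identity on every component. [cite: MochizukiSemiAnbd2006, Def. 2.2(i) p.23] -/
noncomputable def pullbackFunctorIsoLiftOver :
    A.coveringHomCan.pullbackFunctor ≅ A.liftOver A.pullbackV A.pullbackE A.pullbackGlue :=
  NatIso.ofComponents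
    (fun B => BObj.isoMk (fun _ => Iso.refl _) (fun _ => Iso.refl _) (fun bc vc h => by
      change A.fibreData.total.Branch at bc
      change A.fibreData.total.Vertex at vc
      change A.fibreData.total.abuts bc = some vc at h
      rw [Iso.refl_hom, Iso.refl_hom, CategoryTheory.Functor.map_id, Category.id_comp, Category.comp_id,
        liftOver_obj_ψ_hom, pullbackGlue_hom_app, Functor.map_comp]
      change _ = (A.coveringHomCan.gluingIso bc vc h).hom.app B
      rw [Hom.gluingIso]
      simp only [Iso.trans_hom, NatTrans.comp_app, Functor.isoWhiskerLeft_hom, Functor.whiskerLeft_app,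
        Functor.isoWhiskerRight_hom, Functor.whiskerRight_app, Hom.reindexIso, eqToIso.hom, eqToHom_app]
      erw [eqToHom_refl, Category.comp_id]
      rw [coveringHomCan_φB, twoIsoCan_hom_app, Category.assoc]
      rfl))
    (fun {B B'} g => by
      ext
      · change (A.coveringHomCan.pullbackFunctor.map g).fS _ ≫ 𝟙 _ = 𝟙 _ ≫ _
        rw [Category.comp_id, Category.id_comp]
        rfl
      · change (A.coveringHomCan.pullbackFunctor.map g).fT _ ≫ 𝟙 _ = 𝟙 _ ≫ _
        rw [Category.comp_id, Category.id_comp]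
        rfl)

end BObj

end SemiGraphOfAnabelioids

end Literature.AnabelianGeometry.SemiGraphs
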